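import Literature.Probability.Process.ConformalLaplacian
import Literature.Probability.Process.BrownianVecHarmonic
import HarnessLib

/-!
# The conformal time change of planar Brownian motion: definitions

P. Lévy's conformal invariance of planar Brownian motion (Lawler, *Conformally Invariant
Processes in the Plane* (2005), Thm. 2.2; Le Gall (2016), Thm. 7.19): for `f` holomorphic on
`D` and a planar Brownian motion `X = x₀ + W` (`IsBrownianVec`, `d = 2`, read in `ℂ` through
`toC`), stopped at the exit time `ρ = hitTime x₀ W Uᶜ` of a relatively compact open `U ∋ x₀`,
the process `f(X)` run with the **conformal clock** `σ_t = ∫₀ᵗ |f'(X_s)|² ds` inverted is a planar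
Brownian motion. This file only sets up the objects (the theory is in the sequel files
`ConformalMartingaleClock`, `ConformalClock`, `ConformalTimeChange`,
`ConformalStoppedExponential`, …):

* `stopT t ω = t ∧ ρ`, `confPos t ω = X_{t∧ρ}` (the stopped position);
* `confClock t ω = σ_{t∧ρ} = ∫₀^{t∧ρ} |f'(X_r)|² dr` ([Lawler] Thm. 2.2), written with the stopped
  position in the integrand `clockIntegrand` (which changes nothing before `ρ`), and its left
  Riemann sums `clockRiemann` (for adaptedness);
* `clockLevel u`, **`clockInv u = inf{t : σ_t ≥ u} ∧ ρ`** (the inverse clock `α_u`, [Le Gall]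
  Thm. 5.13 "`τ_r = inf{s : ⟨M⟩ₛ > r}`"), `clockInvFun` (the same read in `ℝ≥0`), `totClock = σ_ρ`
  (the total clock `S`, junk when `ρ = ∞`);
* `confExp θ t = exp(i Re(θ̄ f(X_{t∧ρ})) + |θ|² σ_{t∧ρ}/2)` (the conformal exponential
  martingale);
* `tcPos u = f(X_{α_u})` (**the time-changed process** `Ỹ_u`), and `tcEnl W' u`, the
  time-changed process continued after the total clock by an independent planar Brownian motion
  `W'`: `β̃_u = Ỹ_u + W'_{(u − S)⁺}` ([Le Gall] proof of Thm. 5.13, the enlargement).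

## References

* G. F. Lawler, *Conformally Invariant Processes in the Plane*, AMS (2005), Thm. 2.2.
* J.-F. Le Gall, *Brownian Motion, Martingales, and Stochastic Calculus* (2016), Prop. 5.14,
  Thm. 5.13 (Dambis–Dubins–Schwarz), Thm. 7.19 (conformal invariance).
* P. Lévy, *Processus stochastiques et mouvement brownien* (1948), Ch. VI.
-/

noncomputable section

open MeasureTheory Filter Topology Set Complex
open scoped NNReal ENNReal BigOperators ComplexConjugate

namespace Literature.Probability.Process

variable {Ω Ω' : Type*}

namespace IsBrownianVec

/-! ### Stopped time, position, clock -/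

/-- The stopped time `t ∧ ρ_U`, `ρ_U` the exit time of `U` (hitting time of `Uᶜ`) by `x₀ + W`.
[folklore] -/
def stopT (x₀ : Fin 2 → ℝ) (W : ℝ≥0 → Ω → (Fin 2 → ℝ)) (U : Set (Fin 2 → ℝ)) (t : ℝ≥0) (ω : Ω) : ℝ≥0 :=
  (min (t : WithTop ℝ≥0) (hitTime x₀ W Uᶜ ω)).untopA

/-- The stopped position `X_{t ∧ ρ_U}`, `X = x₀ + W`. [folklore] -/
def confPos (x₀ : Fin 2 → ℝ) (W : ℝ≥0 → Ω → (Fin 2 → ℝ)) (U : Set (Fin 2 → ℝ)) (t : ℝ≥0) (ω : Ω) :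
    Fin 2 → ℝ :=
  x₀ + W (stopT x₀ W U t ω) ω

/-- The clock integrand `r ↦ |f'(X_{r∧ρ})|²` in real time. [folklore] -/
def clockIntegrand (x₀ : Fin 2 → ℝ) (W : ℝ≥0 → Ω → (Fin 2 → ℝ)) (f : ℂ → ℂ) (U : Set (Fin 2 → ℝ))
    (ω : Ω) (r : ℝ) : ℝ :=
  ‖deriv f (toC (confPos x₀ W U r.toNNReal ω))‖ ^ 2

/-- **The stopped conformal clock** `σ_{t∧ρ_U} = ∫₀^{t∧ρ_U} |f'(X_r)|² dr` ([Lawler] Thm. 2.2: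
the time change of `f(B)`; the stopped position in the integrand changes nothing before `ρ_U`).
[cite: Lawler2005ConformallyInvariant, Thm. 2.2] -/
def confClock (x₀ : Fin 2 → ℝ) (W : ℝ≥0 → Ω → (Fin 2 → ℝ)) (f : ℂ → ℂ) (U : Set (Fin 2 → ℝ))
    (t : ℝ≥0) (ω : Ω) : ℝ :=
  ∫ r in (0 : ℝ)..(stopT x₀ W U t ω : ℝ), clockIntegrand x₀ W f U ω r

/-- Left Riemann sums of the clock integrand over `[0, t]`. [folklore] -/
def clockRiemann (x₀ : Fin 2 → ℝ) (W : ℝ≥0 → Ω → (Fin 2 → ℝ)) (f : ℂ → ℂ) (U : Set (Fin 2 → ℝ))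
    (t : ℝ≥0) (n : ℕ) (ω : Ω) : ℝ :=
  ∑ k ∈ Finset.range n, ((t : ℝ) - 0) / n * clockIntegrand x₀ W f U ω (0 + k * (((t : ℝ) - 0) / n))

/-- The total clock `S = σ_ρ` (junk when `ρ = ∞`). [folklore] -/
def totClock (x₀ : Fin 2 → ℝ) (W : ℝ≥0 → Ω → (Fin 2 → ℝ)) (f : ℂ → ℂ) (U : Set (Fin 2 → ℝ)) (ω : Ω) : ℝ :=
  confClock x₀ W f U (hitTime x₀ W Uᶜ ω).untopA ω

/-! ### The inverse clock -/

/-- The first passage time of the clock at level `u` (`⊤` if the level is never reached).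
[cite: Legall2016, proof of Thm. 5.13] -/
def clockLevel (x₀ : Fin 2 → ℝ) (W : ℝ≥0 → Ω → (Fin 2 → ℝ)) (f : ℂ → ℂ) (U : Set (Fin 2 → ℝ))
    (u : ℝ≥0) : Ω → WithTop ℝ≥0 :=
  hittingAfter (confClock x₀ W f U) (Ici (u : ℝ)) 0

/-- **The inverse clock** `α_u = inf{t : σ_t ≥ u} ∧ ρ` ([Lawler] Thm. 2.2; [Le Gall] Thm. 5.13,
`τ_r = inf{s : ⟨M⟩ₛ > r}`, capped at the exit time). [cite: Lawler2005ConformallyInvariant, Thm. 2.2] -/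
def clockInv (x₀ : Fin 2 → ℝ) (W : ℝ≥0 → Ω → (Fin 2 → ℝ)) (f : ℂ → ℂ) (U : Set (Fin 2 → ℝ))
    (u : ℝ≥0) (ω : Ω) : WithTop ℝ≥0 :=
  min (clockLevel x₀ W f U u ω) (hitTime x₀ W Uᶜ ω)

/-- The inverse clock as a real-time function `u ↦ α_u` (finite exit time). [folklore] -/
def clockInvFun (x₀ : Fin 2 → ℝ) (W : ℝ≥0 → Ω → (Fin 2 → ℝ)) (f : ℂ → ℂ) (U : Set (Fin 2 → ℝ))
    (ω : Ω) (u : ℝ≥0) : ℝ≥0 :=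
  (clockInv x₀ W f U u ω).untopA

/-! ### The exponential process and the time-changed process -/

/-- **The conformal exponential process** `E^θ_t = exp(i Re(θ̄ f(X_{t∧ρ})) + |θ|² σ_{t∧ρ}/2)`.
[cite: Legall2016, Thm. 5.12 (proof)] -/
def confExp (θ : ℂ) (x₀ : Fin 2 → ℝ) (W : ℝ≥0 → Ω → (Fin 2 → ℝ)) (f : ℂ → ℂ) (U : Set (Fin 2 → ℝ))
    (t : ℝ≥0) (ω : Ω) : ℂ :=
  cexp (I * (rePart θ f (confPos x₀ W U t ω) : ℝ) + (‖θ‖ ^ 2 * confClock x₀ W f U t ω / 2 : ℝ))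

/-- **The time-changed process** `Ỹ_u = f(X_{α_u})` ([Lawler] Thm. 2.2: "`Y_t = f(B_{σ⁻¹(t)})`").
[cite: Lawler2005ConformallyInvariant, Thm. 2.2] -/
def tcPos (x₀ : Fin 2 → ℝ) (W : ℝ≥0 → Ω → (Fin 2 → ℝ)) (f : ℂ → ℂ) (U : Set (Fin 2 → ℝ)) (u : ℝ≥0)
    (ω : Ω) : ℂ :=
  f (toC (stoppedValue (confPos x₀ W U) (clockInv x₀ W f U u) ω))

/-- **The enlarged time-changed process** `β̃_u(ω, ω') = Ỹ_u(ω) + W'_{(u − S(ω))⁺}(ω')`: the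
time-changed process continued, after the total clock `S`, by an independent planar Brownian
motion `W'` ([Le Gall] proof of Thm. 5.13: "we may need to enlarge the probability space").
[cite: Legall2016, Thm. 5.13 (proof)] -/
def tcEnl (x₀ : Fin 2 → ℝ) (W : ℝ≥0 → Ω → (Fin 2 → ℝ)) (f : ℂ → ℂ) (U : Set (Fin 2 → ℝ))
    (W' : ℝ≥0 → Ω' → (Fin 2 → ℝ)) (u : ℝ≥0) (p : Ω × Ω') : ℂ :=
  tcPos x₀ W f U u p.1 + toC (W' ((u : ℝ) - totClock x₀ W f U p.1).toNNReal p.2)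

/-! ### Unfolding lemmas -/

variable {x₀ : Fin 2 → ℝ} {W : ℝ≥0 → Ω → (Fin 2 → ℝ)} {U : Set (Fin 2 → ℝ)} {f : ℂ → ℂ}

/-- `confPos` is the stopped process of `X`. [folklore] -/
theorem confPos_eq_stoppedProcess (t : ℝ≥0) (ω : Ω) :
    confPos x₀ W U t ω = stoppedProcess (fun t ω ↦ x₀ + W t ω) (hitTime x₀ W Uᶜ) t ω := rfl

/-- The clock as a primitive of the clock integrand. [folklore] -/
theorem confClock_eq (t : ℝ≥0) (ω : Ω) :
    confClock x₀ W f U t ω = ∫ r in (0 : ℝ)..(stopT x₀ W U t ω : ℝ), clockIntegrand x₀ W f U ω r := rfl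

/-- Unfolding the clock integrand. [folklore] -/
theorem clockIntegrand_apply (ω : Ω) (r : ℝ) :
    clockIntegrand x₀ W f U ω r = ‖deriv f (toC (confPos x₀ W U r.toNNReal ω))‖ ^ 2 := rfl

/-- The clock integrand is nonnegative. [folklore] -/
theorem clockIntegrand_nonneg (ω : Ω) (r : ℝ) : 0 ≤ clockIntegrand x₀ W f U ω r := by
  unfold clockIntegrand; positivity

/-- Unfolding `clockInvFun`. [folklore] -/
theorem clockInvFun_apply (ω : Ω) (u : ℝ≥0) : clockInvFun x₀ W f U ω u = (clockInv x₀ W f U u ω).untopA := rfl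

/-- The time-changed process is `f` of the stopped value of the stopped position. [folklore] -/
theorem tcPos_apply (u : ℝ≥0) (ω : Ω) :
    tcPos x₀ W f U u ω = f (toC (confPos x₀ W U (clockInvFun x₀ W f U ω u) ω)) := rfl

/-- The stopped time is at most the running time. [folklore] -/
theorem stopT_le (t : ℝ≥0) (ω : Ω) : stopT x₀ W U t ω ≤ t := untopA_min_coe_le t _

/-- `stopT` at time `0` is `0`. [folklore] -/
theorem stopT_zero (ω : Ω) : stopT x₀ W U 0 ω = 0 :=
  le_antisymm (stopT_le 0 ω) bot_le

/-- The clock starts at `0`. [folklore] -/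
theorem confClock_zero (ω : Ω) : confClock x₀ W f U 0 ω = 0 := by
  rw [confClock, stopT_zero]; simp

/-- The inverse clock is at most the exit time. [folklore] -/
theorem clockInv_le_hitTime (u : ℝ≥0) (ω : Ω) : clockInv x₀ W f U u ω ≤ hitTime x₀ W Uᶜ ω :=
  min_le_right _ _

end IsBrownianVec

end Literature.Probability.Process

end
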